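import Mathlib
import Summits.MatrixMultiplication.MatrixMultiplication.Theorems.FourierTwoFamiliesModPPrimeCyclicPowerGainThetaHalfDensity
import Summits.MatrixMultiplication.MatrixMultiplication.Theorems.FourierTwoFamiliesModPPrimeCyclicPowerGainThetaConvolution

/-!
# `ϑ`-CommonFrequencyBias: the value of a theta-body kernel versus the character sums of its diagonal

Crux `stmt-MatrixMultiplication-14309` (`FourierTwoFamiliesModP.PrimeCyclicPowerGain`), line
`clique-coclique-direct-sum-clique`; closes the registered milestone stub `stub_thetaFrequencyBias` of the bet
`stub_thetaBound` (the route's support item `CommonFrequencyBias`, lifted to fractional families).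

Setting as in the sibling file `…ThetaHalfDensity`: `G` a finite additive commutative group, a kernel `B` on block
pairs `v = (v.1, v.2)` that is symmetric, PSD as a real quadratic form, of trace `1`, supported on admissible
equal-or-compatible pairs; `X := Σ_{v,w} B v w`, `N := |G|`.  The diagonal part
`Δ(x) = Σ_v B_vv · #{(a,b) ∈ v.1 × v.2 : a − b = x}` has character sums `Δ̂(ψ) = Σ_v B_vv Σ_{a∈v.1} Σ_{b∈v.2} ψ(a−b)`;
the hypothesis is `‖Δ̂(ψ)‖ ≤ M` for every non-trivial `ψ`.  CONCLUSION (`stub_thetaFrequencyBias`):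
`s² (s² X − N) ≤ M (N s − s² X)` (with the trivial bound `M = s²` this is `ϑ`-HalfDensity `2 s² X ≤ N (s+1)`).

Proof.  The HalfDensity chain `s² = Σ Δ ≥ Σ Δ² = Σ F·Δ` (`F(x) = Σ_{v,w} B_vw · rep v w x`) is kept and its
last step is sharpened.  Pointwise `F(x) = s²X/N + Σ_y Σ_{v,w} f̃_v(y) B_vw g̃_w(y − x)` with the fluctuations
`f̃_v = 1_{v.1} − s/N`, `g̃_w = 1_{w.2} − s/N` (`F_eq_mean_add_fluct`), so `Σ_x F(x)Δ(x) = s⁴X/N + T` with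
`T = Σ_y Σ_{v,w} f̃_v(y) B_vw (θ ∗ g̃_w)(y)`, `θ = Δ − s²/N` (the constant drops out as `g̃_w` has mean zero;
`sum_fluct_mul`).  For every real `t`, `0 ≤ Σ_y (t f̃ + θ∗g̃)(y)ᵀ B (t f̃ + θ∗g̃)(y) = t² P_A + P_g + 2 t T` with
`P_A = s − s²X/N =: P` (`Fluct.fluctA_energy`) and, by the Fourier input `Convolution.conv_energy_le`
(convolution by `θ` contracts the `B`-energy by `(max_ψ ‖θ̂(ψ)‖)² ≤ M²`; `θ̂(ψ) = Δ̂(ψ)` for `ψ ≠ 1` and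
`θ̂(1) = Σ θ = 0`, `char_bound_sub_const`), `P_g ≤ M² P_B = M² P` (`Fluct.fluctB_energy`).  The discriminant
(`neg_mul_le_of_quad_nonneg`) gives `T ≥ −M P`, hence `s² ≥ s⁴X/N − M (s − s²X/N)`; multiply by `N`.
-/


namespace Summit.MatrixMultiplication.MatrixMultiplication.Theorems.PrimeCyclicPowerGainTheta.FrequencyBias

open scoped BigOperators Pointwise ComplexConjugate
open Summit.MatrixMultiplication.MatrixMultiplication.Theorems.PrimeCyclicPowerGainTheta

/-! ### Scalar and kernel bookkeeping -/

/-- **Discriminant step.**  If `t² P + M² P + 2 t T ≥ 0` for every real `t`, with `P, M ≥ 0`, then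
`T ≥ −M P` (for `P > 0` test `t = −T/P`; for `P = 0` test `t = 1`). -/
theorem neg_mul_le_of_quad_nonneg (P M T : ℝ) (hP : 0 ≤ P) (hM : 0 ≤ M)
    (h : ∀ t : ℝ, 0 ≤ t ^ 2 * P + M ^ 2 * P + 2 * t * T) : -(M * P) ≤ T := by
  rcases hP.eq_or_lt with hP0 | hPpos
  · have h1 := h 1
    rw [← hP0] at h1 ⊢; linarith
  · set u : ℝ := T / P with hu
    have hT : T = u * P := by rw [hu]; field_simp
    have ht := h (-u)
    rw [hT] at ht ⊢
    have e : (-u) ^ 2 * P + M ^ 2 * P + 2 * (-u) * (u * P) = M ^ 2 * P - u ^ 2 * P := by ring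
    have h4 : u ^ 2 ≤ M ^ 2 := le_of_mul_le_mul_right (by rw [e] at ht; linarith) hPpos
    have h6 := mul_le_mul_of_nonneg_right (abs_le_of_sq_le_sq' h4 hM).1 hPpos.le
    linarith

/-- The quadratic form at `t • x + y` is nonnegative: `0 ≤ t² xᵀBx + yᵀBy + 2 t xᵀBy` (symmetric PSD `B`). -/
theorem quad_param_nonneg {V : Type*} [Fintype V] (B : V → V → ℝ) (hsymm : ∀ v w, B v w = B w v)
    (hpsd : ∀ x : V → ℝ, 0 ≤ ∑ v, ∑ w, x v * B v w * x w) (x y : V → ℝ) (t : ℝ) :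
    0 ≤ t ^ 2 * ∑ v, ∑ w, x v * B v w * x w + ∑ v, ∑ w, y v * B v w * y w +
      2 * t * ∑ v, ∑ w, x v * B v w * y w := by
  have h := hpsd fun v => t * x v + y v
  have hq := Kernel.quad_add B hsymm (fun v => t * x v) y
  have e1 : ∑ v, ∑ w, t * x v * B v w * (t * x w) = t ^ 2 * ∑ v, ∑ w, x v * B v w * x w := by
    simp only [Finset.mul_sum]
    exact Finset.sum_congr rfl fun v _ => Finset.sum_congr rfl fun w _ => by ring
  have e2 : ∑ v, ∑ w, t * x v * B v w * y w = t * ∑ v, ∑ w, x v * B v w * y w := by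
    simp only [Finset.mul_sum]
    exact Finset.sum_congr rfl fun v _ => Finset.sum_congr rfl fun w _ => by ring
  rw [hq, e1, e2] at h
  linarith

/-- Rearranging a `B`-energy: `Σ_y Σ_{v,w} F_v(y) B_vw F_w(y) = Σ_{v,w} B_vw Σ_y F_v(y) F_w(y)`. -/
theorem energy_comm {Y V : Type*} [Fintype Y] [Fintype V] (B : V → V → ℝ) (Fn : V → Y → ℝ) :
    ∑ y, ∑ v, ∑ w, Fn v y * B v w * Fn w y = ∑ v, ∑ w, B v w * ∑ y, Fn v y * Fn w y := by
  rw [Finset.sum_comm]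
  refine Finset.sum_congr rfl fun v _ => ?_
  rw [Finset.sum_comm]
  refine Finset.sum_congr rfl fun w _ => ?_
  rw [Finset.mul_sum]; exact Finset.sum_congr rfl fun y _ => by ring

section Group

variable {G : Type*} [AddCommGroup G] [Fintype G] [DecidableEq G]

/-- The fluctuation (mean-zero part) of the indicator of `S`, written in place:
`fl[S, y] = 1_S(y) − |S| / |G|` (a local notation, so that all statements stay raw finite sums). -/
local notation3 "fl[" S ", " y "]" =>
  ((if y ∈ S then (1 : ℝ) else 0) - ((Finset.card S : ℕ) : ℝ) / (Fintype.card G : ℝ))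

omit [DecidableEq G] in
/-- Reindexing by the reflection `x ↦ y − x`: `Σ_x f (y − x) = Σ_x f x`. -/
theorem sum_sub_left (f : G → ℝ) (y : G) : ∑ x, f (y - x) = ∑ x, f x :=
  Fintype.sum_equiv (Equiv.subLeft y) _ _ fun _ => rfl

/-! ### Step 1: mean / fluctuation split of `F` and of `Σ F·Δ` -/

/-- **Pointwise mean/fluctuation split of `F`**: if the nonzero entries of `B` sit on blocks of side-size `s`,
`F(x) = Σ_{v,w} B_vw · rep v w x = s² X / |G| + Σ_y Σ_{v,w} fl[v.1, y] · B_vw · fl[w.2, y − x]`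
(the two mixed mean×fluctuation terms vanish). -/
theorem F_eq_mean_add_fluct (s : ℕ) (B : Finset G × Finset G → Finset G × Finset G → ℝ)
    (hc : ∀ v w : Finset G × Finset G, B v w ≠ 0 →
      v.1.card = s ∧ v.2.card = s ∧ w.1.card = s ∧ w.2.card = s) (x : G) :
    ∑ v, ∑ w, B v w * ∑ a ∈ v.1, ∑ b ∈ w.2, (if a - b = x then (1 : ℝ) else 0) =
      (s : ℝ) ^ 2 * (∑ v, ∑ w, B v w) / (Fintype.card G : ℝ) +
        ∑ y, ∑ v, ∑ w, fl[v.1, y] * B v w * fl[w.2, y - x] := by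
  have hN : (0 : ℝ) < Fintype.card G := by exact_mod_cast Fintype.card_pos
  set N : ℝ := (Fintype.card G : ℝ) with hNdef
  set X : ℝ := ∑ v, ∑ w, B v w with hXdef
  set fA : Finset G × Finset G → G → ℝ := fun v y => if y ∈ v.1 then 1 else 0 with hfA
  set gB : Finset G × Finset G → G → ℝ := fun w z => if z ∈ w.2 then 1 else 0 with hgB
  set cA : Finset G × Finset G → ℝ := fun v => (v.1.card : ℝ) / N with hcA
  set cB : Finset G × Finset G → ℝ := fun w => (w.2.card : ℝ) / N with hcB
  set ft : Finset G × Finset G → G → ℝ := fun v y => fA v y - cA v with hft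
  set gt : Finset G × Finset G → G → ℝ := fun w z => gB w z - cB w with hgt
  rw [Fluct.F_eq_sum B x]
  change ∑ y, ∑ v, ∑ w, fA v y * B v w * gB w (y - x) =
    (s : ℝ) ^ 2 * X / N + ∑ y, ∑ v, ∑ w, ft v y * B v w * gt w (y - x)
  have hsplit : ∑ y, ∑ v, ∑ w, fA v y * B v w * gB w (y - x) =
      ∑ _y : G, ∑ v, ∑ w, cA v * B v w * cB w
      + ∑ y, ∑ v, ∑ w, cA v * B v w * gt w (y - x)
      + ∑ y, ∑ v, ∑ w, ft v y * B v w * cB w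
      + ∑ y, ∑ v, ∑ w, ft v y * B v w * gt w (y - x) := by
    simp only [← Finset.sum_add_distrib]
    apply Finset.sum_congr rfl; intro y _
    apply Finset.sum_congr rfl; intro v _
    apply Finset.sum_congr rfl; intro w _
    simp only [hft, hgt]; ring
  have hT1 : ∑ _y : G, ∑ v, ∑ w, cA v * B v w * cB w = (s : ℝ) ^ 2 * X / N := by
    rw [Finset.sum_const, Finset.card_univ, nsmul_eq_mul]
    have : ∑ v, ∑ w, cA v * B v w * cB w = ∑ v, ∑ w, B v w * ((s : ℝ) ^ 2 / N ^ 2) := by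
      apply Finset.sum_congr rfl; intro v _
      apply Finset.sum_congr rfl; intro w _
      by_cases hB : B v w = 0
      · rw [hB]; ring
      · obtain ⟨h1, -, -, h4⟩ := hc v w hB
        simp only [hcA, hcB, h1, h4]; ring
    rw [this]
    simp only [← Finset.sum_mul]
    rw [← hXdef, ← hNdef]
    field_simp
  have hT2 : ∑ y, ∑ v, ∑ w, cA v * B v w * gt w (y - x) = 0 := by
    rw [Finset.sum_comm]
    apply Finset.sum_eq_zero; intro v _
    rw [Finset.sum_comm]
    apply Finset.sum_eq_zero; intro w _
    rw [← Finset.mul_sum, Rep.sum_sub_arg (fun z => gt w z) x]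
    have : ∑ z, gt w z = 0 := by simp only [hgt, hgB, hcB]; exact Rep.sum_fluct w.2
    rw [this, mul_zero]
  have hT3 : ∑ y, ∑ v, ∑ w, ft v y * B v w * cB w = 0 := by
    rw [Finset.sum_comm]
    apply Finset.sum_eq_zero; intro v _
    rw [Finset.sum_comm]
    apply Finset.sum_eq_zero; intro w _
    have hre : ∀ y : G, ft v y * B v w * cB w = ft v y * (B v w * cB w) := fun y => by ring
    rw [Finset.sum_congr rfl fun y _ => hre y, ← Finset.sum_mul]
    have : ∑ y, ft v y = 0 := by simp only [hft, hfA, hcA]; exact Rep.sum_fluct v.1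
    rw [this, zero_mul]
  rw [hsplit, hT1, hT2, hT3]
  ring

/-- **Testing the fluctuation part of `F` against a function `D`**: for every constant `c`,
`Σ_x (Σ_y Σ_{v,w} f̃_v(y) B_vw g̃_w(y − x)) · D x = Σ_y Σ_{v,w} f̃_v(y) B_vw ((D − c) ∗ g̃_w)(y)`
with `(θ ∗ h)(y) = Σ_x θ x · h (y − x)`; the constant drops out because `g̃_w = fl[w.2, ·]` has mean zero. -/
theorem sum_fluct_mul (B : Finset G × Finset G → Finset G × Finset G → ℝ) (D : G → ℝ) (c : ℝ) :
    ∑ x, (∑ y, ∑ v, ∑ w, fl[v.1, y] * B v w * fl[w.2, y - x]) * D x =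
      ∑ y, ∑ v, ∑ w, fl[v.1, y] * B v w * ∑ x, (D x - c) * fl[w.2, y - x] := by
  have hin : ∀ (w : Finset G × Finset G) (y : G),
      ∑ x, (D x - c) * fl[w.2, y - x] = ∑ x, D x * fl[w.2, y - x] := by
    intro w y
    have h0 : ∑ x, fl[w.2, y - x] = 0 := by
      rw [sum_sub_left (fun z => fl[w.2, z]) y]; exact Rep.sum_fluct w.2
    simp only [sub_mul, Finset.sum_sub_distrib, ← Finset.mul_sum, h0, mul_zero, sub_zero]
  simp_rw [hin]
  calc ∑ x, (∑ y, ∑ v, ∑ w, fl[v.1, y] * B v w * fl[w.2, y - x]) * D x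
      = ∑ x, ∑ y, ∑ v, ∑ w, fl[v.1, y] * B v w * (D x * fl[w.2, y - x]) := by
        simp only [Finset.sum_mul]
        exact Finset.sum_congr rfl fun x _ => Finset.sum_congr rfl fun y _ =>
          Finset.sum_congr rfl fun v _ => Finset.sum_congr rfl fun w _ => by ring
    _ = ∑ y, ∑ x, ∑ v, ∑ w, fl[v.1, y] * B v w * (D x * fl[w.2, y - x]) := Finset.sum_comm
    _ = ∑ y, ∑ v, ∑ w, ∑ x, fl[v.1, y] * B v w * (D x * fl[w.2, y - x]) := by
        refine Finset.sum_congr rfl fun y _ => ?_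
        rw [Finset.sum_comm]
        exact Finset.sum_congr rfl fun v _ => Finset.sum_comm
    _ = ∑ y, ∑ v, ∑ w, fl[v.1, y] * B v w * ∑ x, D x * fl[w.2, y - x] := by
        refine Finset.sum_congr rfl fun y _ => Finset.sum_congr rfl fun v _ =>
          Finset.sum_congr rfl fun w _ => ?_
        rw [Finset.mul_sum]

/-! ### Step 2: the character sums of the diagonal part -/

/-- **Character sums of `Δ`**: for every `φ : G → ℂ`,
`Σ_x Δ(x) · φ x = Σ_v B_vv Σ_{a ∈ v.1} Σ_{b ∈ v.2} φ (a − b)`. -/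
theorem sum_delta_mul (B : Finset G × Finset G → Finset G × Finset G → ℝ) (φ : G → ℂ) :
    ∑ x, ((∑ v, B v v * ∑ a ∈ v.1, ∑ b ∈ v.2, (if a - b = x then (1 : ℝ) else 0) : ℝ) : ℂ) * φ x =
      ∑ v, (B v v : ℂ) * ∑ a ∈ v.1, ∑ b ∈ v.2, φ (a - b) := by
  have h1 : ∀ x : G,
      ((∑ v, B v v * ∑ a ∈ v.1, ∑ b ∈ v.2, (if a - b = x then (1 : ℝ) else 0) : ℝ) : ℂ) * φ x =
        ∑ v, (B v v : ℂ) * ∑ a ∈ v.1, ∑ b ∈ v.2, (if a - b = x then φ x else 0) := by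
    intro x
    rw [Complex.ofReal_sum, Finset.sum_mul]
    refine Finset.sum_congr rfl fun v _ => ?_
    rw [Complex.ofReal_mul, Complex.ofReal_sum, mul_assoc, Finset.sum_mul]
    congr 1
    refine Finset.sum_congr rfl fun a _ => ?_
    rw [Complex.ofReal_sum, Finset.sum_mul]
    refine Finset.sum_congr rfl fun b _ => ?_
    split_ifs <;> simp
  rw [Finset.sum_congr rfl fun x _ => h1 x, Finset.sum_comm]
  refine Finset.sum_congr rfl fun v _ => ?_
  rw [← Finset.mul_sum]
  congr 1
  rw [Finset.sum_comm]
  refine Finset.sum_congr rfl fun a _ => ?_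
  rw [Finset.sum_comm]
  refine Finset.sum_congr rfl fun b _ => ?_
  rw [Finset.sum_ite_eq]
  simp

omit [DecidableEq G] in
/-- **Character sums of `D − c` are bounded by `M`** when `Σ D = |G| · c` (so the sum at the trivial character
is `0 ≤ M`) and `‖Σ_x D x ψ x‖ ≤ M` for `ψ ≠ 1` (then the constant drops out because `Σ_x ψ x = 0`). -/
theorem char_bound_sub_const (D : G → ℝ) (c M : ℝ) (hM0 : 0 ≤ M)
    (hsum : ∑ x, D x = (Fintype.card G : ℝ) * c)
    (hM : ∀ ψ : AddChar G ℂ, ψ ≠ 1 → ‖∑ x, (D x : ℂ) * ψ x‖ ≤ M) (ψ : AddChar G ℂ) :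
    ‖∑ x, ((D x - c : ℝ) : ℂ) * ψ x‖ ≤ M := by
  have hsplit : ∑ x, ((D x - c : ℝ) : ℂ) * ψ x = ∑ x, (D x : ℂ) * ψ x - (c : ℂ) * ∑ x, ψ x := by
    rw [Finset.mul_sum, ← Finset.sum_sub_distrib]
    refine Finset.sum_congr rfl fun x _ => ?_
    push_cast; ring
  by_cases hψ : ψ = 0
  · subst hψ
    have h1 : ∑ x, ((D x - c : ℝ) : ℂ) * (0 : AddChar G ℂ) x = ((∑ x, (D x - c) : ℝ) : ℂ) := by
      rw [Complex.ofReal_sum]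
      exact Finset.sum_congr rfl fun x _ => by rw [AddChar.zero_apply, mul_one]
    rw [h1, Finset.sum_sub_distrib, hsum, Finset.sum_const, Finset.card_univ, nsmul_eq_mul, sub_self,
      Complex.ofReal_zero, norm_zero]
    exact hM0
  · rw [hsplit, AddChar.sum_eq_zero_iff_ne_zero.2 hψ, mul_zero, sub_zero]
    exact hM ψ hψ

/-! ### Step 3: the cross term is at least `−M · P` -/

/-- **Lower bound for the cross term** `T = Σ_y Σ_{v,w} f̃_v(y) B_vw (θ ∗ g̃_w)(y) ≥ −M · (s − s² X / |G|)` for a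
symmetric PSD trace-one kernel supported on blocks of side `s` with pairwise disjoint first sides and pairwise
disjoint second sides, and any real `θ` whose character sums are bounded by `M ≥ 0` (polarisation with a
parameter, `Fluct.fluctA_energy` / `fluctB_energy`, `Convolution.conv_energy_le`, discriminant). -/
theorem cross_lower (s : ℕ) (B : Finset G × Finset G → Finset G × Finset G → ℝ) (M : ℝ)
    (hsymm : ∀ v w, B v w = B w v)
    (hpsd : ∀ x : Finset G × Finset G → ℝ, 0 ≤ ∑ v, ∑ w, x v * B v w * x w)
    (hc : ∀ v w : Finset G × Finset G, B v w ≠ 0 →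
      v.1.card = s ∧ v.2.card = s ∧ w.1.card = s ∧ w.2.card = s)
    (hdA : ∀ v w : Finset G × Finset G, B v w ≠ 0 → v ≠ w → Disjoint v.1 w.1)
    (hdB : ∀ v w : Finset G × Finset G, B v w ≠ 0 → v ≠ w → Disjoint v.2 w.2)
    (htr : ∑ v, B v v = 1) (hM0 : 0 ≤ M) (θ : G → ℝ)
    (hθ : ∀ ψ : AddChar G ℂ, ‖∑ x, (θ x : ℂ) * ψ x‖ ≤ M) :
    -(M * ((s : ℝ) - (s : ℝ) ^ 2 / (Fintype.card G : ℝ) * ∑ v, ∑ w, B v w)) ≤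
      ∑ y, ∑ v, ∑ w, fl[v.1, y] * B v w * ∑ x, θ x * fl[w.2, y - x] := by
  set P : ℝ := (s : ℝ) - (s : ℝ) ^ 2 / (Fintype.card G : ℝ) * ∑ v, ∑ w, B v w with hP
  set g : Finset G × Finset G → G → ℝ := fun w y => ∑ x, θ x * fl[w.2, y - x] with hg
  change -(M * P) ≤ ∑ y, ∑ v, ∑ w, fl[v.1, y] * B v w * g w y
  have hPA : ∑ y, ∑ v, ∑ w, fl[v.1, y] * B v w * fl[w.1, y] = P := by
    have h := Fluct.fluctA_energy (G := G) s B (fun v w hB => ⟨(hc v w hB).1, (hc v w hB).2.2.1⟩) hdA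
    rwa [htr, mul_one] at h
  have hPB : ∑ y, ∑ v, ∑ w, fl[v.2, y] * B v w * fl[w.2, y] = P := by
    have h := Fluct.fluctB_energy (G := G) s B (fun v w hB => ⟨(hc v w hB).2.1, (hc v w hB).2.2.2⟩) hdB
    rwa [htr, mul_one] at h
  have hP0 : 0 ≤ P := by rw [← hPA]; exact Finset.sum_nonneg fun y _ => hpsd fun v => fl[v.1, y]
  have hPg : ∑ y, ∑ v, ∑ w, g v y * B v w * g w y ≤ M ^ 2 * P := by
    rw [energy_comm B g, ← hPB, energy_comm B (fun v y => fl[v.2, y])]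
    exact Convolution.conv_energy_le B (fun w z => fl[w.2, z]) θ M hpsd hθ
  have hquad : ∀ t : ℝ, 0 ≤ t ^ 2 * P + M ^ 2 * P +
      2 * t * ∑ y, ∑ v, ∑ w, fl[v.1, y] * B v w * g w y := by
    intro t
    have hpt : ∀ y : G, 0 ≤ t ^ 2 * ∑ v, ∑ w, fl[v.1, y] * B v w * fl[w.1, y] +
        ∑ v, ∑ w, g v y * B v w * g w y + 2 * t * ∑ v, ∑ w, fl[v.1, y] * B v w * g w y :=
      fun y => quad_param_nonneg B hsymm hpsd (fun v => fl[v.1, y]) (fun w => g w y) t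
    have hsum := Finset.sum_nonneg fun y (_ : y ∈ (Finset.univ : Finset G)) => hpt y
    rw [Finset.sum_add_distrib, Finset.sum_add_distrib, ← Finset.mul_sum, ← Finset.mul_sum, hPA] at hsum
    linarith [hPg]
  exact neg_mul_le_of_quad_nonneg P M _ hP0 hM0 hquad

/-- **The sharpened lower bound for `Σ F·D`.**  Under the hypotheses of `cross_lower`, for every real `D` and
constant `c` such that the character sums of `D − c` are bounded by `M`:
`(s² X / |G|) · Σ_x D x − M · (s − s² X / |G|) ≤ Σ_x F(x) · D x`
(`F_eq_mean_add_fluct`, `sum_fluct_mul`, `cross_lower`). -/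
theorem sum_F_mul_lower (s : ℕ) (B : Finset G × Finset G → Finset G × Finset G → ℝ) (M : ℝ)
    (hsymm : ∀ v w, B v w = B w v)
    (hpsd : ∀ x : Finset G × Finset G → ℝ, 0 ≤ ∑ v, ∑ w, x v * B v w * x w)
    (hc : ∀ v w : Finset G × Finset G, B v w ≠ 0 →
      v.1.card = s ∧ v.2.card = s ∧ w.1.card = s ∧ w.2.card = s)
    (hdA : ∀ v w : Finset G × Finset G, B v w ≠ 0 → v ≠ w → Disjoint v.1 w.1)
    (hdB : ∀ v w : Finset G × Finset G, B v w ≠ 0 → v ≠ w → Disjoint v.2 w.2)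
    (htr : ∑ v, B v v = 1) (hM0 : 0 ≤ M) (D : G → ℝ) (c : ℝ)
    (hθ : ∀ ψ : AddChar G ℂ, ‖∑ x, ((D x - c : ℝ) : ℂ) * ψ x‖ ≤ M) :
    (s : ℝ) ^ 2 * (∑ v, ∑ w, B v w) / (Fintype.card G : ℝ) * ∑ x, D x -
        M * ((s : ℝ) - (s : ℝ) ^ 2 / (Fintype.card G : ℝ) * ∑ v, ∑ w, B v w) ≤
      ∑ x, (∑ v, ∑ w, B v w * ∑ a ∈ v.1, ∑ b ∈ w.2, (if a - b = x then (1 : ℝ) else 0)) * D x := by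
  have hT := cross_lower s B M hsymm hpsd hc hdA hdB htr hM0 (fun x => D x - c) hθ
  have h1 : ∀ x, (∑ v, ∑ w, B v w * ∑ a ∈ v.1, ∑ b ∈ w.2, (if a - b = x then (1 : ℝ) else 0)) * D x =
      (s : ℝ) ^ 2 * (∑ v, ∑ w, B v w) / (Fintype.card G : ℝ) * D x +
        (∑ y, ∑ v, ∑ w, fl[v.1, y] * B v w * fl[w.2, y - x]) * D x := by
    intro x
    rw [F_eq_mean_add_fluct s B hc x, add_mul]
  rw [Finset.sum_congr rfl fun x _ => h1 x, Finset.sum_add_distrib, ← Finset.mul_sum, sum_fluct_mul B D c]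
  linarith

end Group

/-! ### Step 4: assembly -/

/-- **Registered milestone stub `stub_thetaFrequencyBias` — `ϑ`-CommonFrequencyBias** (crux
stmt-MatrixMultiplication-14309, line clique-coclique-direct-sum-clique; the route's support item
`CommonFrequencyBias` lifted to fractional families, milestone of the bet `stub_thetaBound`).  For `s ≥ 1`, a
symmetric PSD trace-one kernel `B` on block pairs of a finite abelian group `G`, supported on admissible
equal-or-compatible pairs, and `M ≥ 0` bounding the character sums
`‖Σ_v B_vv Σ_{a ∈ v.1} Σ_{b ∈ v.2} ψ(a − b)‖` of its diagonal part at every non-trivial `ψ : AddChar G ℂ`: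
`s² · (s² · Σ_{v,w} B v w − |G|) ≤ M · (|G| · s − s² · Σ_{v,w} B v w)`. -/
theorem stub_thetaFrequencyBias :
    ∀ (G : Type) [AddCommGroup G] [Fintype G] [DecidableEq G] (s : ℕ), 1 ≤ s →
      ∀ (X₀ : Finset G) (B : Finset G × Finset G → Finset G × Finset G → ℝ) (M : ℝ),
      (∀ v w, B v w = B w v) →
      (∀ x : Finset G × Finset G → ℝ, 0 ≤ ∑ v, ∑ w, x v * B v w * x w) →
      (∀ v w : Finset G × Finset G, B v w ≠ 0 →
        (v.1.card = s ∧ v.2.card = s ∧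
          (∀ a ∈ v.1, ∀ a' ∈ v.1, ∀ b ∈ v.2, ∀ b' ∈ v.2, (a - a') + (b - b') = 0 → a = a' ∧ b = b') ∧
          v.1 - v.2 ⊆ X₀) ∧
        (w.1.card = s ∧ w.2.card = s ∧
          (∀ a ∈ w.1, ∀ a' ∈ w.1, ∀ b ∈ w.2, ∀ b' ∈ w.2, (a - a') + (b - b') = 0 → a = a' ∧ b = b') ∧
          w.1 - w.2 ⊆ X₀) ∧
        (v = w ∨ (Disjoint (v.1 - w.2) X₀ ∧ Disjoint (w.1 - v.2) X₀))) →
      ∑ v, B v v = 1 →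
      0 ≤ M →
      (∀ ψ : AddChar G ℂ, ψ ≠ 1 →
        ‖∑ v, (B v v : ℂ) * ∑ a ∈ v.1, ∑ b ∈ v.2, ψ (a - b)‖ ≤ M) →
      (s : ℝ) ^ 2 * ((s : ℝ) ^ 2 * (∑ v, ∑ w, B v w) - (Fintype.card G : ℝ)) ≤
        M * ((Fintype.card G : ℝ) * (s : ℝ) - (s : ℝ) ^ 2 * ∑ v, ∑ w, B v w) := by
  intro G _ _ _ s hs X₀ B M hsymm hpsd hsupp htr hM0 hM
  have hN : (0 : ℝ) < Fintype.card G := by exact_mod_cast Fintype.card_pos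
  -- derived support facts (as in `HalfDensity.two_mul_sq_mul_value_le`)
  have hW : ∀ v : Finset G × Finset G, B v v ≠ 0 →
      ∀ a ∈ v.1, ∀ a' ∈ v.1, ∀ b ∈ v.2, ∀ b' ∈ v.2, (a - a') + (b - b') = 0 → a = a' ∧ b = b' :=
    fun v h => (hsupp v v h).1.2.2.1
  have hcard : ∀ v : Finset G × Finset G, B v v ≠ 0 → v.1.card = s ∧ v.2.card = s :=
    fun v h => ⟨(hsupp v v h).1.1, (hsupp v v h).1.2.1⟩
  have hD : ∀ v : Finset G × Finset G, B v v ≠ 0 → v.1 - v.2 ⊆ X₀ := fun v h => (hsupp v v h).1.2.2.2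
  have hX : ∀ v w : Finset G × Finset G, B v w ≠ 0 → v ≠ w → Disjoint (v.1 - w.2) X₀ :=
    fun v w h hvw => ((hsupp v w h).2.2.resolve_left hvw).1
  have hc : ∀ v w : Finset G × Finset G, B v w ≠ 0 →
      v.1.card = s ∧ v.2.card = s ∧ w.1.card = s ∧ w.2.card = s :=
    fun v w h => ⟨(hsupp v w h).1.1, (hsupp v w h).1.2.1, (hsupp v w h).2.1.1, (hsupp v w h).2.1.2.1⟩
  have hdA : ∀ v w : Finset G × Finset G, B v w ≠ 0 → v ≠ w → Disjoint v.1 w.1 := by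
    intro v w h hvw
    obtain ⟨⟨_, hv2, _, hvD⟩, _, hcomp⟩ := hsupp v w h
    obtain ⟨b, hb⟩ : v.2.Nonempty := by rw [← Finset.card_pos, hv2]; exact hs
    exact Finset.disjoint_left.2 fun a hav haw => Finset.disjoint_left.1 (hcomp.resolve_left hvw).2
      (Finset.sub_mem_sub haw hb) (hvD (Finset.sub_mem_sub hav hb))
  have hdB : ∀ v w : Finset G × Finset G, B v w ≠ 0 → v ≠ w → Disjoint v.2 w.2 := by
    intro v w h hvw
    obtain ⟨⟨hv1, _, _, hvD⟩, _, hcomp⟩ := hsupp v w h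
    obtain ⟨a, ha⟩ : v.1.Nonempty := by rw [← Finset.card_pos, hv1]; exact hs
    exact Finset.disjoint_left.2 fun b hbv hbw => Finset.disjoint_left.1 (hcomp.resolve_left hvw).1
      (Finset.sub_mem_sub ha hbw) (hvD (Finset.sub_mem_sub ha hbv))
  -- the HalfDensity chain  Σ FΔ = Σ Δ² ≤ Σ Δ = s²
  set Δ : G → ℝ := fun x => ∑ v, B v v * ∑ a ∈ v.1, ∑ b ∈ v.2, (if a - b = x then (1 : ℝ) else 0)
    with hΔ
  set F : G → ℝ := fun x => ∑ v, ∑ w, B v w * ∑ a ∈ v.1, ∑ b ∈ w.2, (if a - b = x then (1 : ℝ) else 0)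
    with hF
  have hΔsum : ∑ x, Δ x = (s : ℝ) ^ 2 := HalfDensity.sum_delta s B hcard htr
  have hmid : ∑ x, F x * Δ x = ∑ x, Δ x * Δ x :=
    Finset.sum_congr rfl fun x _ => HalfDensity.F_mul_delta_eq X₀ B hD hX x
  have hup : ∑ x, Δ x * Δ x ≤ (s : ℝ) ^ 2 := by
    rw [← hΔsum]
    refine Finset.sum_le_sum fun x _ => ?_
    calc Δ x * Δ x ≤ Δ x * 1 := mul_le_mul_of_nonneg_left (HalfDensity.delta_le_one B hpsd hW htr x)
          (HalfDensity.delta_nonneg B hpsd x)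
      _ = Δ x := mul_one _
  -- the sharpened lower bound (Fourier input)
  have hθM : ∀ ψ : AddChar G ℂ,
      ‖∑ x, ((Δ x - (s : ℝ) ^ 2 / (Fintype.card G : ℝ) : ℝ) : ℂ) * ψ x‖ ≤ M := by
    refine char_bound_sub_const Δ ((s : ℝ) ^ 2 / (Fintype.card G : ℝ)) M hM0
      (by rw [hΔsum]; field_simp) fun ψ hψ => ?_
    have h := hM ψ hψ
    rwa [← sum_delta_mul B ψ] at h
  have hlow : (s : ℝ) ^ 2 * (∑ v, ∑ w, B v w) / (Fintype.card G : ℝ) * ∑ x, Δ x -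
      M * ((s : ℝ) - (s : ℝ) ^ 2 / (Fintype.card G : ℝ) * ∑ v, ∑ w, B v w) ≤ ∑ x, F x * Δ x :=
    sum_F_mul_lower s B M hsymm hpsd hc hdA hdB htr hM0 Δ _ hθM
  rw [hΔsum] at hlow
  have key : (s : ℝ) ^ 2 * (∑ v, ∑ w, B v w) / (Fintype.card G : ℝ) * (s : ℝ) ^ 2 -
      M * ((s : ℝ) - (s : ℝ) ^ 2 / (Fintype.card G : ℝ) * ∑ v, ∑ w, B v w) ≤ (s : ℝ) ^ 2 := by
    linarith [hlow, hmid, hup]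
  have key2 := mul_le_mul_of_nonneg_right key hN.le
  have e : ((s : ℝ) ^ 2 * (∑ v, ∑ w, B v w) / (Fintype.card G : ℝ) * (s : ℝ) ^ 2 -
      M * ((s : ℝ) - (s : ℝ) ^ 2 / (Fintype.card G : ℝ) * ∑ v, ∑ w, B v w)) * (Fintype.card G : ℝ) =
      (s : ℝ) ^ 2 * ((s : ℝ) ^ 2 * ∑ v, ∑ w, B v w) -
        M * ((Fintype.card G : ℝ) * (s : ℝ) - (s : ℝ) ^ 2 * ∑ v, ∑ w, B v w) := by
    field_simp
  rw [e] at key2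
  linarith

end Summit.MatrixMultiplication.MatrixMultiplication.Theorems.PrimeCyclicPowerGainTheta.FrequencyBias
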